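import Literature.AlgebraicGeometry.HodgeTheory.WeightOneHodgeStructuresOfTori
import Mathlib.LinearAlgebra.Matrix.PosDef
import HarnessLib

/-!
# Route `SecondaryPeriods` — crux `RiemannWeightOne` (stmt-HodgeConjecture-16406), line `birth`: stub `stub_siegelForm`

The registered stub `stub_siegelForm` of the line skeleton
`Summits/HodgeConjecture/HodgeConjecture/Cruxes/RiemannWeightOne/Lines/birth.lean`, proved
unconditionally: the **Siegel normal form** of a polarised weight-one structure in a symplectic basis.

**Statement.** Let `J` be a complex structure on `V_ℝ = ℝ ⊗_ℚ V` (`J² = -1`), `E` a rational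
alternating form with the Riemann relations in the tree's sign convention
(`E_ℝ(Ja, Jc) = E_ℝ(a, c)`, `E_ℝ(a, Ja) > 0` for `a ≠ 0`), and `b` a symplectic `ℚ`-basis of
`(V, E)` indexed by `Fin n ⊕ Fin n` (`E(b₁ᵢ, b₁ⱼ) = E(b₂ᵢ, b₂ⱼ) = 0`, `E(b₁ᵢ, b₂ⱼ) = δᵢⱼ`). Then there
is a real-linear isomorphism `Ψ : V_ℝ ≃ ℂⁿ` with `Ψ(Ja) = iΨ(a)`, `Ψ(1 ⊗ b₁ᵢ) = eᵢ`, and the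
coordinates `Ω` of the other half, `Ψ(1 ⊗ b₂ⱼ) = (Ωᵢⱼ)ᵢ`, form a symmetric matrix with `Im Ω`
positive definite (Lange–Birkenhake, *Complex Abelian Varieties*, §8.1; Birkenhake–Lange 2004,
Prop. 8.1.1: the period matrix of a principally polarised abelian variety with respect to a
symplectic basis is `(Ω, 1)` with `Ω` in the Siegel upper half space).

**Proof.** Write `vᵢ = 1 ⊗ b₁ᵢ`, `uⱼ = 1 ⊗ b₂ⱼ`, `U = ⟨vᵢ⟩_ℝ`, `g(x, y) = E_ℝ(x, Jy)` (symmetric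
positive definite). `U` is `E_ℝ`-isotropic, so `U ∩ JU = 0` (`w ∈ U`, `Jw ∈ U` gives
`g(w, w) = E_ℝ(w, Jw) = 0`); hence `T(z) = Σ Re zᵢ · vᵢ + Im zᵢ · Jvᵢ` is an injective, hence
bijective (`dim_ℝ V_ℝ = 2n`), real-linear map `ℂⁿ → V_ℝ` with `J ∘ T = T ∘ i`; `Ψ = T⁻¹`. Writing
`uⱼ = Σᵢ Aᵢⱼ vᵢ + Bᵢⱼ Jvᵢ` (`Ω = A + iB`) and `G = (g(v_k, vᵢ))`, the relation `E(b₁, b₂) = 1`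
reads `GB = 1`, so `B = G⁻¹` is symmetric positive definite, and `E(b₂, b₂) = 0` reads
`Aᵀ(GB) = (GB)ᵀA`, i.e. `A` is symmetric.

## References

* [LangeBirkenhake1992] H. Lange, Ch. Birkenhake, Complex Abelian Varieties (1992), §8.1
  (PDF p. 231 ff.), and §4.1–4.2 (Riemann relations in a symplectic basis).
* Ch. Birkenhake, H. Lange, Complex Abelian Varieties, 2nd ed. (2004), Prop. 8.1.1.
-/

noncomputable section

-- every declaration of this problem lives in `Summit.HodgeConjecture.HodgeConjecture.…`
set_option linter.dupNamespace false

namespace Summit.HodgeConjecture.HodgeConjecture.Theorems.RiemannWeightOne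

open scoped TensorProduct Matrix
open Literature.AlgebraicGeometry.Motives
open Literature.AlgebraicGeometry.Motives.HodgeStructure

/-- **Siegel normal form** (the registered stub `stub_siegelForm` of the line `birth`, verbatim).
For a complex structure `J` on `V_ℝ = ℝ ⊗_ℚ V`, a rational alternating form `E` with
`E_ℝ(Ja, Jc) = E_ℝ(a, c)` and `E_ℝ(a, Ja) > 0` (`a ≠ 0`), and a symplectic basis `b` of `(V, E)`
indexed by `Fin n ⊕ Fin n`, the vectors `1 ⊗ b₁ᵢ` form a `ℂ`-basis of `(V_ℝ, J)`: there is a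
real-linear isomorphism `Ψ : V_ℝ ≃ ℂⁿ` with `Ψ(Ja) = iΨ(a)`, `Ψ(1 ⊗ b₁ᵢ) = eᵢ`, and the coordinate
matrix `Ω` of the other half (`Ψ(1 ⊗ b₂ⱼ) = (Ωᵢⱼ)ᵢ`) is symmetric with `Im Ω` positive definite
(`Im Ω = G⁻¹` for the Gram matrix `G = (E_ℝ(1 ⊗ b₁ₖ, J(1 ⊗ b₁ᵢ)))`).
[cite: LangeBirkenhake1992, §8.1] -/
theorem stub_siegelForm :
    ∀ ⦃V : Type⦄ [AddCommGroup V] [Module ℚ V] [Module.Finite ℚ V]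
      (J : ℝ ⊗[ℚ] V →ₗ[ℝ] ℝ ⊗[ℚ] V) (_hJ : ∀ a, J (J a) = -a) (E : LinearMap.BilinForm ℚ V),
      (∀ x y, E y x = -E x y) → (∀ a c, E.baseChange ℝ (J a) (J c) = E.baseChange ℝ a c) →
      (∀ a, a ≠ 0 → 0 < E.baseChange ℝ a (J a)) →
      ∀ ⦃n : ℕ⦄ (b : Module.Basis (Fin n ⊕ Fin n) ℚ V),
      (∀ i j, E (b (Sum.inl i)) (b (Sum.inl j)) = 0) →
      (∀ i j, E (b (Sum.inr i)) (b (Sum.inr j)) = 0) →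
      (∀ i j, E (b (Sum.inl i)) (b (Sum.inr j)) = if i = j then 1 else 0) →
      ∃ (Ψ : ℝ ⊗[ℚ] V ≃ₗ[ℝ] (Fin n → ℂ)) (Ω : Matrix (Fin n) (Fin n) ℂ),
        (∀ a, Ψ (J a) = Complex.I • Ψ a) ∧
        (∀ i j, Ω i j = Ω j i) ∧
        (Matrix.of fun i j => (Ω i j).im).PosDef ∧
        (∀ i, Ψ ((1 : ℝ) ⊗ₜ[ℚ] b (Sum.inl i)) = Pi.single i 1) ∧
        (∀ j, Ψ ((1 : ℝ) ⊗ₜ[ℚ] b (Sum.inr j)) = fun i => Ω i j) := by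
  intro V _ _ _ J hJ E hE hEJ hpos n b h11 h22 h12
  classical
  -- the two halves of the basis, transported to `V_ℝ`
  obtain ⟨v, hv⟩ : ∃ v : Fin n → ℝ ⊗[ℚ] V, ∀ i, v i = (1 : ℝ) ⊗ₜ[ℚ] b (Sum.inl i) :=
    ⟨_, fun _ => rfl⟩
  obtain ⟨u, hu⟩ : ∃ u : Fin n → ℝ ⊗[ℚ] V, ∀ j, u j = (1 : ℝ) ⊗ₜ[ℚ] b (Sum.inr j) :=
    ⟨_, fun _ => rfl⟩
  have hvv : ∀ k i, E.baseChange ℝ (v k) (v i) = 0 := fun k i => by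
    rw [hv, hv, LinearMap.BilinForm.baseChange_tmul, h11, zero_smul]
  have huu : ∀ j l, E.baseChange ℝ (u j) (u l) = 0 := fun j l => by
    rw [hu, hu, LinearMap.BilinForm.baseChange_tmul, h22, zero_smul]
  have hvu : ∀ k j, E.baseChange ℝ (v k) (u j) = if k = j then 1 else 0 := fun k j => by
    rw [hv, hu, LinearMap.BilinForm.baseChange_tmul, h12, mul_one]
    split_ifs <;> simp
  -- skew-symmetry of `E_ℝ`, `J`-adjointness, symmetry of `g(x, y) = E_ℝ(x, Jy)`
  have hswap : ∀ a c, E.baseChange ℝ c a = -E.baseChange ℝ a c := baseChange_real_swap E hE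
  have hJl : ∀ a c, E.baseChange ℝ (J a) c = -E.baseChange ℝ a (J c) :=
    Literature.AlgebraicGeometry.HodgeTheory.baseChange_real_J_left J E hJ hEJ
  have hgsym : ∀ x y, E.baseChange ℝ x (J y) = E.baseChange ℝ y (J x) := fun x y => by
    rw [hswap (J y) x, hJl y x, neg_neg]
  -- `vec c = Σ cᵢ vᵢ`, the real span `U` of the first half
  obtain ⟨vec, hvec⟩ : ∃ vec : (Fin n → ℝ) →ₗ[ℝ] ℝ ⊗[ℚ] V, ∀ c, vec c = ∑ i, c i • v i :=
    ⟨Fintype.linearCombination ℝ v, fun _ => rfl⟩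
  have hUv : ∀ k c, E.baseChange ℝ (v k) (vec c) = 0 := fun k c => by
    rw [hvec, map_sum]
    exact Finset.sum_eq_zero fun i _ => by rw [map_smul, hvv, smul_zero]
  have hUU : ∀ a c, E.baseChange ℝ (vec a) (vec c) = 0 := fun a c => by
    rw [hvec a, map_sum, LinearMap.sum_apply]
    exact Finset.sum_eq_zero fun i _ => by rw [map_smul, LinearMap.smul_apply, hUv, smul_zero]
  -- the Gram matrix `G` of `g` on the first half
  obtain ⟨G, hG⟩ : ∃ G : Matrix (Fin n) (Fin n) ℝ,
      ∀ k i, G k i = E.baseChange ℝ (v k) (J (v i)) :=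
    ⟨Matrix.of fun k i => E.baseChange ℝ (v k) (J (v i)), fun _ _ => rfl⟩
  have hGsym : ∀ k i, G k i = G i k := fun k i => by rw [hG, hG, hgsym]
  have hvJvec : ∀ k c, E.baseChange ℝ (v k) (J (vec c)) = ∑ i, G k i * c i := fun k c => by
    rw [hvec, map_sum, map_sum]
    exact Finset.sum_congr rfl fun i _ => by rw [map_smul, map_smul, hG, smul_eq_mul, mul_comm]
  have hEvecJvec : ∀ a c, E.baseChange ℝ (vec a) (J (vec c)) = ∑ k, a k * ∑ i, G k i * c i :=
    fun a c => by
    rw [hvec a, map_sum, LinearMap.sum_apply]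
    exact Finset.sum_congr rfl fun k _ => by
      rw [map_smul, LinearMap.smul_apply, hvJvec, smul_eq_mul]
  have hETT : ∀ a c a' c', E.baseChange ℝ (vec a + J (vec c)) (vec a' + J (vec c')) =
      E.baseChange ℝ (vec a) (J (vec c')) - E.baseChange ℝ (vec a') (J (vec c)) := by
    intro a c a' c'
    simp only [map_add, LinearMap.add_apply]
    rw [hEJ, hUU, hUU, hJl, hgsym (vec c) (vec a')]
    abel
  -- the first half is linearly independent over `ℝ`
  have hli : LinearIndependent ℝ v := by
    have h := (b.baseChange ℝ).linearIndependent.comp Sum.inl Sum.inl_injective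
    have hv' : v = ⇑(b.baseChange ℝ) ∘ Sum.inl := funext fun i => by
      rw [hv i, Function.comp_apply, Module.Basis.baseChange_apply]
    rwa [hv']
  have hvec0 : ∀ c, vec c = 0 → c = 0 := fun c hc =>
    funext fun i => Fintype.linearIndependent_iff.1 hli c (by rw [← hvec]; exact hc) i
  -- `G` is symmetric positive definite
  have hGpos : G.PosDef := by
    refine Matrix.PosDef.of_dotProduct_mulVec_pos
      (Matrix.IsHermitian.ext fun k i => by rw [star_trivial, hGsym]) fun x hx => ?_
    have hne : vec x ≠ 0 := fun h => hx (hvec0 x h)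
    have h := hpos (vec x) hne
    rw [hEvecJvec] at h
    have hdot : star x ⬝ᵥ (G *ᵥ x) = ∑ k, x k * ∑ i, G k i * x i := by
      simp only [star_trivial, dotProduct, Matrix.mulVec]
    rwa [hdot]
  -- the real-linear map `T : ℂⁿ → V_ℝ`, `z ↦ Σ Re zᵢ · vᵢ + Im zᵢ · Jvᵢ`
  obtain ⟨T, hT⟩ : ∃ T : (Fin n → ℂ) →ₗ[ℝ] ℝ ⊗[ℚ] V,
      ∀ z, T z = vec (fun i => (z i).re) + J (vec (fun i => (z i).im)) :=
    ⟨vec ∘ₗ Complex.reLm.compLeft (Fin n) + J ∘ₗ vec ∘ₗ Complex.imLm.compLeft (Fin n),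
      fun z => rfl⟩
  have hTinj : Function.Injective T := by
    rw [injective_iff_map_eq_zero]
    intro z hz
    rw [hT] at hz
    have hw0 : (fun i => (z i).im) = 0 := by
      refine hvec0 _ ?_
      by_contra hne
      have h1 := hpos _ hne
      rw [eq_neg_of_add_eq_zero_right hz, map_neg, hUU, neg_zero] at h1
      exact lt_irrefl _ h1
    have hp0 : (fun i => (z i).re) = 0 := by
      refine hvec0 _ ?_
      rwa [hw0, map_zero, map_zero, add_zero] at hz
    funext i
    apply Complex.ext
    · simpa using congrFun hp0 i
    · simpa using congrFun hw0 i
  have hfin : Module.finrank ℝ (Fin n → ℂ) = Module.finrank ℝ (ℝ ⊗[ℚ] V) := by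
    rw [Module.finrank_eq_card_basis (b.baseChange ℝ), Module.finrank_pi_fintype]
    simp only [Complex.finrank_real_complex, Finset.sum_const, Finset.card_univ, Fintype.card_fin,
      Fintype.card_sum, smul_eq_mul]
    ring
  have hTbij : Function.Bijective T :=
    ⟨hTinj, (LinearMap.injective_iff_surjective_of_finrank_eq_finrank hfin).1 hTinj⟩
  -- `J ∘ T = T ∘ i` and `T eᵢ = vᵢ`
  have hJT : ∀ z, J (T z) = T (Complex.I • z) := fun z => by
    have h1 : (fun i => ((Complex.I • z) i).re) = -fun i => (z i).im := by
      funext i; simp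
    have h2 : (fun i => ((Complex.I • z) i).im) = fun i => (z i).re := by
      funext i; simp
    rw [hT, hT, h1, h2, map_add, hJ, map_neg]
    abel
  have hTsingle : ∀ i, T (Pi.single i 1) = v i := fun i => by
    have h1 : (fun k => ((Pi.single i (1 : ℂ) : Fin n → ℂ) k).re) = Pi.single i (1 : ℝ) := by
      funext k
      by_cases h : k = i
      · subst h; simp
      · simp [Pi.single_eq_of_ne h]
    have h2 : (fun k => ((Pi.single i (1 : ℂ) : Fin n → ℂ) k).im) = 0 := by
      funext k
      by_cases h : k = i
      · subst h; simp
      · simp [Pi.single_eq_of_ne h]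
    rw [hT, h1, h2, map_zero, map_zero, add_zero, hvec, Finset.sum_eq_single i
      (fun k _ hk => by rw [Pi.single_eq_of_ne hk, zero_smul]) (fun h => absurd (Finset.mem_univ i) h),
      Pi.single_eq_same, one_smul]
  -- `Ψ = T⁻¹`
  obtain ⟨Ψ, hΨT, hTΨ⟩ : ∃ Ψ : ℝ ⊗[ℚ] V ≃ₗ[ℝ] (Fin n → ℂ),
      (∀ z, Ψ (T z) = z) ∧ ∀ a, T (Ψ a) = a :=
    ⟨(LinearEquiv.ofBijective T hTbij).symm, LinearEquiv.ofBijective_symm_apply_apply T,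
      LinearEquiv.apply_ofBijective_symm_apply T⟩
  have hΨJ : ∀ a, Ψ (J a) = Complex.I • Ψ a := fun a => by
    conv_lhs => rw [← hTΨ a, hJT]
    exact hΨT _
  have hΨv : ∀ i, Ψ (v i) = Pi.single i 1 := fun i => by rw [← hTsingle, hΨT]
  -- coordinates of the second half: `uⱼ = Σᵢ Aᵢⱼ vᵢ + Bᵢⱼ Jvᵢ`, `Ωᵢⱼ = Ψ(uⱼ)ᵢ = Aᵢⱼ + iBᵢⱼ`
  -- `GB = 1`
  have hGB : ∀ k j, ∑ i, G k i * (Ψ (u j) i).im = if k = j then 1 else 0 := fun k j => by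
    have h := hvu k j
    rw [← hTΨ (u j), hT, map_add, hUv, zero_add, hvJvec] at h
    exact h
  obtain ⟨B, hB⟩ : ∃ B : Matrix (Fin n) (Fin n) ℝ, ∀ i j, B i j = (Ψ (u j) i).im :=
    ⟨Matrix.of fun i j => (Ψ (u j) i).im, fun _ _ => rfl⟩
  have hGBm : G * B = 1 := by
    ext k j
    rw [Matrix.mul_apply, Matrix.one_apply]
    simp_rw [hB]
    exact hGB k j
  have hBpos : B.PosDef := by
    rw [← Matrix.inv_eq_right_inv hGBm]
    exact hGpos.inv
  have hBsym : ∀ i j, B i j = B j i := fun i j => by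
    simpa only [star_trivial] using hBpos.isHermitian.apply j i
  -- `A` is symmetric, from `E(b₂, b₂) = 0`
  have hAsym : ∀ j l, (Ψ (u j) l).re = (Ψ (u l) j).re := fun j l => by
    have h := huu j l
    rw [← hTΨ (u j), ← hTΨ (u l), hT, hT, hETT, hEvecJvec, hEvecJvec] at h
    simp_rw [hGB] at h
    simpa [sub_eq_zero] using h
  refine ⟨Ψ, Matrix.of fun i j => Ψ (u j) i, hΨJ, fun i j => ?_, ?_, fun i => ?_, fun j => ?_⟩
  · -- `Ω` symmetric
    simp only [Matrix.of_apply]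
    exact Complex.ext (hAsym j i) (by rw [← hB, ← hB, hBsym])
  · -- `Im Ω = B = G⁻¹` positive definite
    have hB' : (Matrix.of fun i j => ((Matrix.of fun i j => Ψ (u j) i) i j).im) = B := by
      ext i j
      rw [Matrix.of_apply, Matrix.of_apply, hB]
    rw [hB']
    exact hBpos
  · rw [← hv]
    exact hΨv i
  · rw [← hu]
    funext i
    rw [Matrix.of_apply]

end Summit.HodgeConjecture.HodgeConjecture.Theorems.RiemannWeightOne

end
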